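import Summits.MatrixMultiplication.MatrixMultiplication.Theorems.FarEdgeDescentLineAllChar
import Summits.MatrixMultiplication.MatrixMultiplication.Theorems.FarEdgeDescentClassAntichain
import HarnessLib

/-!
# Pencil Gram invariants of the BCZ line, VI: all eight single deletions, every field

Route `FarEdgeDescent` (cell `decomp-mm`, lens 2 «structural dichotomy (special vs generic)»,
gen 40), Kernel XV-c; support for the aside `SubLogRate` (stmt-MatrixMultiplication-25371).

Part III (`FarEdgeDescentClassAntichain`) transported the degeneration order of the closed BCZ
line to the tensors: the full-support class `{supp T = S}` (`S = supp ⟨2,2,2⟩`, eight entries)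
and the corank-one class `{supp T = S ∖ {p₀}}` at the ONE deleted entry `p₀ = pt 1 1 0` of
Bläser–Christandl–Zuiddam, the mixed pairs in characteristic `≠ 2` only.  This part removes both
restrictions:

* `fam_zero_ne_zero_iff`, `sameSupport_fam_zero_iff`: `supp 𝔖(0) = S ∖ {p₀}` as a statement
  about `𝔖(1)`;
* "every tensor with support `S ∖ {p}` is `≡ 𝔖(0)`" (mutual restriction) and its **transport
  along the permutation isotropy of `⟨2,2,2⟩`** — the three commuting involutions of
  `FarEdgeDescentSpecialClass` §3 fix `𝔖(1)` and act transitively on `S` (`(ℤ/2)³`-torsor):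
  `equivZero_at_p₀`, `equivZero_transport`, `equivZero_side/row/col`; hence (no definitions)
  **`equiv_fam_zero_of_deleted`: a tensor whose support is `S` minus ANY ONE of its eight
  entries is a mutual restriction of `𝔖(0)`** (`equiv_fam_zero_of_deleted'` for an entry given
  by the support condition), and `deleted_restrictsTo`: all eight deletion classes form ONE
  `≅`-class although their supports differ;
* the closed class **modulo the isotropy**, `{supp T = S} ∪ {T ≡ 𝔖(0)}`, over EVERY field
  (Part V supplies `𝔖(q) ⋭ 𝔖(0)` without `2 ≠ 0`): `sameSupport_not_algDegeneratesTo_equivZero`,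
  `equivZero_not_algDegeneratesTo_sameSupport`, `closedClass_algDegeneratesTo_iff_restrictsTo`,
  `closedClass_no_strict_degeneration`, `closedClass_comparable_iff`, `matMul_closedClass`,
  `matMul_deleted_incomparable` — degeneration is restriction, there is no strict degeneration,
  and `⟨2,2,2⟩` is incomparable with each of its eight single deletions, over every field;
* the support-level corollaries `closedSupport_equiv`, `closedSupport_no_strict_degeneration`
  for `supp T = S ∨ ∃ σ i k, supp T = S ∖ {pt σ i k}`.

Lens reading (special vs generic): the "special" stratum of the closed support class of `⟨2,2,2⟩`
is now the full isotropy orbit of the BCZ deletion — eight supports, one `≅`-class — and the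
finite level of the dichotomy (no member of the closed class degenerates to another
`≅`-class) holds over every field; whatever distinguishes special from generic members for `ω`
is invisible to `⊴` at `N = 1` and lives in the asymptotic functionals of the cut
`FiniteSaturation ∧ AnchoredLogConvexity`.

References: M. Bläser, M. Christandl, J. Zuiddam, arXiv:1705.09652, §2, Def. 5, Lemma 3
[BlaserChristandlZuiddam2017]; P. Bürgisser, M. Clausen, M. A. Shokrollahi, *Algebraic Complexity
Theory* (1997), (15.19), (15.24)(2), (15.25), §20.2 [BurgisserClausenShokrollahi1997];
H. F. de Groote, *On varieties of optimal algorithms for the computation of bilinear mappings I.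
The isotropy group of a bilinear mapping*, Theor. Comput. Sci. 7 (1978) [folklore for the
permutation part used here].
-/

noncomputable section

open scoped BigOperators

set_option linter.dupNamespace false

namespace Summit.MatrixMultiplication.MatrixMultiplication.Theorems.FarEdgeDescentCorankOneClasses

open Literature.Computability.AlgebraicComplexity
open Summit.MatrixMultiplication.MatrixMultiplication.Theorems.FarEdgeDescentSignTwist
open Summit.MatrixMultiplication.MatrixMultiplication.Theorems.FarEdgeDescentSignTwistDet (Leaf2)
open Summit.MatrixMultiplication.MatrixMultiplication.Theorems.FarEdgeDescentWeightFamily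
  (famW fam fam_one)
open Summit.MatrixMultiplication.MatrixMultiplication.Theorems.FarEdgeDescentWeightFamilyDet
  (fam_zero_not_algDegeneratesTo_matMul)
open Summit.MatrixMultiplication.MatrixMultiplication.Theorems.FarEdgeDescentZeroWeightBorderRank
  (fam_one_restricts)
open Summit.MatrixMultiplication.MatrixMultiplication.Theorems.FarEdgeDescentSpecialClass
open Summit.MatrixMultiplication.MatrixMultiplication.Theorems.FarEdgeDescentLineRigidity
  (fam_zero_not_algDegeneratesTo_fam matMul_not_algDegeneratesTo_fam_zero)
open Summit.MatrixMultiplication.MatrixMultiplication.Theorems.FarEdgeDescentClassAntichain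
  (algDegeneratesTo_congr exists_equiv_fam_of_sameSupport equiv_fam_zero_of_sameSupport
    sameSupport_algDegeneratesTo_iff_restrictsTo sameSupport_no_strict_degeneration)
open Summit.MatrixMultiplication.MatrixMultiplication.Theorems.FarEdgeDescentLineAllChar
  (fam_not_algDegeneratesTo_fam_zero)

variable {K : Type} [Field K] {T T' : Leaf2 → (Fin 2 × Fin 2) → Leaf2 → K}

/-! ## §1 The support of `𝔖(0)` relative to `𝔖(1)` -/

/-- The deleted entry predicate is "`= pt 1 1 0`". [cite: BlaserChristandlZuiddam2017, Def. 5] -/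
theorem isP0_iff (a : Leaf2) (x : Fin 2 × Fin 2) (c : Leaf2) :
    IsP0 a x c ↔ (a, x, c) = pt 1 1 0 := by
  rw [pt_one_one_zero]
  simp only [IsP0, Prod.mk.injEq]

/-- **`supp 𝔖(0) = supp 𝔖(1) ∖ {p₀}`**, pointwise. [cite: BlaserChristandlZuiddam2017, Def. 5] -/
theorem fam_zero_ne_zero_iff (a : Leaf2) (x : Fin 2 × Fin 2) (c : Leaf2) :
    fam K 0 a x c ≠ 0 ↔ (fam K 1 a x c ≠ 0 ∧ (a, x, c) ≠ pt 1 1 0) := by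
  by_cases hp : IsP0 a x c
  · have e := (isP0_iff a x c).mp hp
    obtain ⟨rfl, rfl, rfl⟩ := hp
    rw [fam_zero_p₀]
    exact ⟨fun h => absurd rfl h, fun h => absurd e h.2⟩
  · rw [fam_apply_of_not_isP0 (1 : K) hp]
    exact ⟨fun h => ⟨h, fun e => hp ((isP0_iff a x c).mpr e)⟩, fun h => h.1⟩

/-- `supp T = supp 𝔖(0)` iff `supp T = supp 𝔖(1) ∖ {p₀}`.
[cite: BlaserChristandlZuiddam2017, Def. 5] -/
theorem sameSupport_fam_zero_iff :
    SameSupport T (fam K 0) ↔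
      ∀ a x c, (T a x c ≠ 0 ↔ (fam K 1 a x c ≠ 0 ∧ (a, x, c) ≠ pt 1 1 0)) := by
  unfold SameSupport
  exact forall₃_congr fun a x c => iff_congr Iff.rfl (fam_zero_ne_zero_iff a x c)

/-! ## §2 Transport of the corank-one class along the permutation isotropy of `⟨2,2,2⟩` -/

/-- **Base**: every tensor with support `S ∖ {p₀}`, `p₀ = pt 1 1 0` the BCZ entry, is a mutual
restriction of `𝔖(0)` (torus normal form, Part III). [cite: BlaserChristandlZuiddam2017, Lemma 3] -/
theorem equivZero_at_p₀ :
    ∀ T : Leaf2 → (Fin 2 × Fin 2) → Leaf2 → K,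
      (∀ a x c, (T a x c ≠ 0 ↔ (fam K 1 a x c ≠ 0 ∧ (a, x, c) ≠ pt 1 1 0))) →
        TensorRestrictsTo T (fam K 0) ∧ TensorRestrictsTo (fam K 0) T := fun _ hT =>
  equiv_fam_zero_of_sameSupport K (sameSupport_fam_zero_iff.mpr hT)

/-- Pulling a deletion back along a symmetry of `𝔖(1)`: if `supp T = S ∖ {e p}` then
`supp (T ∘ e) = S ∖ {p}`. [cite: BurgisserClausenShokrollahi1997, (15.24)] -/
theorem deleted_precomp {e₁ e₃ : Leaf2 ≃ Leaf2} {e₂ : (Fin 2 × Fin 2) ≃ (Fin 2 × Fin 2)}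
    (he : (fun a x c => fam K 1 (e₁ a) (e₂ x) (e₃ c)) = fam K 1)
    {p : Leaf2 × (Fin 2 × Fin 2) × Leaf2}
    (hT : ∀ a x c, (T a x c ≠ 0 ↔ (fam K 1 a x c ≠ 0 ∧ (a, x, c) ≠ (e₁ p.1, e₂ p.2.1, e₃ p.2.2)))) :
    ∀ a x c, ((fun a x c => T (e₁ a) (e₂ x) (e₃ c)) a x c ≠ 0 ↔
      (fam K 1 a x c ≠ 0 ∧ (a, x, c) ≠ p)) := by
  intro a x c
  have e : fam K 1 (e₁ a) (e₂ x) (e₃ c) = fam K 1 a x c := congrFun (congrFun (congrFun he a) x) c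
  rw [hT, e]
  refine and_congr Iff.rfl (not_congr ?_)
  obtain ⟨p₁, p₂, p₃⟩ := p
  simp only [Prod.mk.injEq, e₁.apply_eq_iff_eq, e₂.apply_eq_iff_eq, e₃.apply_eq_iff_eq]

/-- **Transport**: a symmetry `e` of `𝔖(1)` carries "every deletion at `p` is `≡ 𝔖(0)`" to the
same statement at `e p` — `T ≡ T ∘ e ≡ 𝔖(0)`.
[cite: BurgisserClausenShokrollahi1997, (15.24), (15.25)] -/
theorem equivZero_transport {e₁ e₃ : Leaf2 ≃ Leaf2} {e₂ : (Fin 2 × Fin 2) ≃ (Fin 2 × Fin 2)}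
    (he : (fun a x c => fam K 1 (e₁ a) (e₂ x) (e₃ c)) = fam K 1)
    {p : Leaf2 × (Fin 2 × Fin 2) × Leaf2}
    (H : ∀ T : Leaf2 → (Fin 2 × Fin 2) → Leaf2 → K,
      (∀ a x c, (T a x c ≠ 0 ↔ (fam K 1 a x c ≠ 0 ∧ (a, x, c) ≠ p))) →
        TensorRestrictsTo T (fam K 0) ∧ TensorRestrictsTo (fam K 0) T) :
    ∀ T : Leaf2 → (Fin 2 × Fin 2) → Leaf2 → K,
      (∀ a x c, (T a x c ≠ 0 ↔ (fam K 1 a x c ≠ 0 ∧ (a, x, c) ≠ (e₁ p.1, e₂ p.2.1, e₃ p.2.2)))) →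
        TensorRestrictsTo T (fam K 0) ∧ TensorRestrictsTo (fam K 0) T := fun T hT => by
  obtain ⟨h₁, h₂⟩ := H (fun a x c => T (e₁ a) (e₂ x) (e₃ c)) (deleted_precomp he hT)
  exact ⟨(tensorRestrictsTo_precomp T e₁ e₂ e₃).trans h₁,
    h₂.trans (tensorRestrictsTo_of_reindex T e₁ e₂ e₃)⟩

/-- Transport across the side swap: `pt 1 i k ↦ pt 0 i k`. [folklore] -/
theorem equivZero_side {i k : Fin 2}
    (H : ∀ T : Leaf2 → (Fin 2 × Fin 2) → Leaf2 → K,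
      (∀ a x c, (T a x c ≠ 0 ↔ (fam K 1 a x c ≠ 0 ∧ (a, x, c) ≠ pt 1 i k))) →
        TensorRestrictsTo T (fam K 0) ∧ TensorRestrictsTo (fam K 0) T) :
    ∀ T : Leaf2 → (Fin 2 × Fin 2) → Leaf2 → K,
      (∀ a x c, (T a x c ≠ 0 ↔ (fam K 1 a x c ≠ 0 ∧ (a, x, c) ≠ pt 0 i k))) →
        TensorRestrictsTo T (fam K 0) ∧ TensorRestrictsTo (fam K 0) T := by
  have h := equivZero_transport (fam_one_sideSwap (K := K)) H
  rwa [sideSwap_pt] at h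

/-- Transport across the first row flip: `pt σ 1 k ↦ pt σ 0 k`. [folklore] -/
theorem equivZero_row {σ k : Fin 2}
    (H : ∀ T : Leaf2 → (Fin 2 × Fin 2) → Leaf2 → K,
      (∀ a x c, (T a x c ≠ 0 ↔ (fam K 1 a x c ≠ 0 ∧ (a, x, c) ≠ pt σ 1 k))) →
        TensorRestrictsTo T (fam K 0) ∧ TensorRestrictsTo (fam K 0) T) :
    ∀ T : Leaf2 → (Fin 2 × Fin 2) → Leaf2 → K,
      (∀ a x c, (T a x c ≠ 0 ↔ (fam K 1 a x c ≠ 0 ∧ (a, x, c) ≠ pt σ 0 k))) →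
        TensorRestrictsTo T (fam K 0) ∧ TensorRestrictsTo (fam K 0) T := by
  have h := equivZero_transport (fam_one_flipRow (K := K)) H
  rwa [flipRow_pt] at h

/-- Transport across the second row flip: `pt σ i 0 ↦ pt σ i 1`. [folklore] -/
theorem equivZero_col {σ i : Fin 2}
    (H : ∀ T : Leaf2 → (Fin 2 × Fin 2) → Leaf2 → K,
      (∀ a x c, (T a x c ≠ 0 ↔ (fam K 1 a x c ≠ 0 ∧ (a, x, c) ≠ pt σ i 0))) →
        TensorRestrictsTo T (fam K 0) ∧ TensorRestrictsTo (fam K 0) T) :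
    ∀ T : Leaf2 → (Fin 2 × Fin 2) → Leaf2 → K,
      (∀ a x c, (T a x c ≠ 0 ↔ (fam K 1 a x c ≠ 0 ∧ (a, x, c) ≠ pt σ i 1))) →
        TensorRestrictsTo T (fam K 0) ∧ TensorRestrictsTo (fam K 0) T := by
  have h := equivZero_transport (fam_one_flipCol (K := K)) H
  rwa [flipCol_pt] at h

/-! ## §3 Every single deletion of `⟨2,2,2⟩` is `≡ 𝔖(0)` (def-free statements) -/

/-- **A tensor whose support is `supp ⟨2,2,2⟩` minus any one entry `pt σ i k` is a mutual
restriction of `𝔖(0)`**, over every field — the isotropy `(ℤ/2)³` generated by the three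
involutions is transitive on `supp ⟨2,2,2⟩`. [cite: BlaserChristandlZuiddam2017, Lemma 3]
[cite: BurgisserClausenShokrollahi1997, (15.24)] -/
theorem equiv_fam_zero_of_deleted (σ i k : Fin 2)
    (hT : ∀ a x c, (T a x c ≠ 0 ↔ (fam K 1 a x c ≠ 0 ∧ (a, x, c) ≠ pt σ i k))) :
    TensorRestrictsTo T (fam K 0) ∧ TensorRestrictsTo (fam K 0) T := by
  have b := equivZero_at_p₀ (K := K)
  revert T
  fin_cases σ <;> fin_cases i <;> fin_cases k
  · exact equivZero_side (equivZero_row b) _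
  · exact equivZero_side (equivZero_row (equivZero_col b)) _
  · exact equivZero_side b _
  · exact equivZero_side (equivZero_col b) _
  · exact equivZero_row b _
  · exact equivZero_row (equivZero_col b) _
  · exact b _
  · exact equivZero_col b _

/-- The same for a deleted entry `p` given by the support condition `𝔖(1) p ≠ 0`.
[cite: BlaserChristandlZuiddam2017, Lemma 3] -/
theorem equiv_fam_zero_of_deleted' {p : Leaf2 × (Fin 2 × Fin 2) × Leaf2}
    (hp : fam K 1 p.1 p.2.1 p.2.2 ≠ 0)
    (hT : ∀ a x c, (T a x c ≠ 0 ↔ (fam K 1 a x c ≠ 0 ∧ (a, x, c) ≠ p))) :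
    TensorRestrictsTo T (fam K 0) ∧ TensorRestrictsTo (fam K 0) T := by
  obtain ⟨σ, i, k, e⟩ := exists_pt_of_cond p.1 p.2.1 p.2.2 ((fam_one_ne_zero_iff _ _ _).mp hp)
  have e' : p = pt σ i k := e
  subst e'
  exact equiv_fam_zero_of_deleted σ i k hT

/-- **All eight deletion classes are ONE `≅`-class**: tensors supported on `S ∖ {pt σ i k}` and
on `S ∖ {pt σ' i' k'}` are mutual restrictions, although their supports differ when
`(σ,i,k) ≠ (σ',i',k')`. [cite: BlaserChristandlZuiddam2017, Lemma 3] -/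
theorem deleted_restrictsTo {σ i k σ' i' k' : Fin 2}
    (hT : ∀ a x c, (T a x c ≠ 0 ↔ (fam K 1 a x c ≠ 0 ∧ (a, x, c) ≠ pt σ i k)))
    (hT' : ∀ a x c, (T' a x c ≠ 0 ↔ (fam K 1 a x c ≠ 0 ∧ (a, x, c) ≠ pt σ' i' k'))) :
    TensorRestrictsTo T T' :=
  (equiv_fam_zero_of_deleted σ i k hT).1.trans (equiv_fam_zero_of_deleted σ' i' k' hT').2

/-! ## §4 The closed class modulo the isotropy, over EVERY field -/

/-- **A full-support member degenerates to no tensor `≡ 𝔖(0)`**, every field (Part V).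
[cite: BurgisserClausenShokrollahi1997, (15.19)] [cite: HodgePedoe1994, Bk IV Ch. XIII §10] -/
theorem sameSupport_not_algDegeneratesTo_equivZero (hT : SameSupport T (fam K 1))
    (hT' : TensorRestrictsTo T' (fam K 0) ∧ TensorRestrictsTo (fam K 0) T') :
    ¬ AlgDegeneratesTo T T' := fun hd => by
  obtain ⟨q, hq, h₁, h₂⟩ := exists_equiv_fam_of_sameSupport K hT
  exact fam_not_algDegeneratesTo_fam_zero K hq
    ((algDegeneratesTo_congr K h₁ h₂ hT'.1 hT'.2).mp hd)

/-- **A tensor `≡ 𝔖(0)` degenerates to no full-support member**, every field.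
[cite: BurgisserClausenShokrollahi1997, (15.19)] -/
theorem equivZero_not_algDegeneratesTo_sameSupport
    (hT : TensorRestrictsTo T (fam K 0) ∧ TensorRestrictsTo (fam K 0) T)
    (hT' : SameSupport T' (fam K 1)) : ¬ AlgDegeneratesTo T T' := fun hd => by
  obtain ⟨q', hq', h₃, h₄⟩ := exists_equiv_fam_of_sameSupport K hT'
  exact fam_zero_not_algDegeneratesTo_fam K hq' ((algDegeneratesTo_congr K hT.1 hT.2 h₃ h₄).mp hd)

/-- **On the closed class degeneration is restriction**, every field.
[cite: BurgisserClausenShokrollahi1997, §20.2] -/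
theorem closedClass_algDegeneratesTo_iff_restrictsTo
    (hT : SameSupport T (fam K 1) ∨ (TensorRestrictsTo T (fam K 0) ∧ TensorRestrictsTo (fam K 0) T))
    (hT' : SameSupport T' (fam K 1) ∨
      (TensorRestrictsTo T' (fam K 0) ∧ TensorRestrictsTo (fam K 0) T')) :
    AlgDegeneratesTo T T' ↔ TensorRestrictsTo T T' := by
  refine ⟨fun hd => ?_, fun h => h.algDegeneratesTo⟩
  rcases hT with hT | hT <;> rcases hT' with hT' | hT'
  · exact (sameSupport_algDegeneratesTo_iff_restrictsTo K hT hT').mp hd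
  · exact absurd hd (sameSupport_not_algDegeneratesTo_equivZero hT hT')
  · exact absurd hd (equivZero_not_algDegeneratesTo_sameSupport hT hT')
  · exact hT.1.trans hT'.2

/-- **On the closed class there is no strict degeneration**, every field: `T ⊵ T' ↔ T' ⊵ T`.
[cite: BurgisserClausenShokrollahi1997, §20.2] -/
theorem closedClass_no_strict_degeneration
    (hT : SameSupport T (fam K 1) ∨ (TensorRestrictsTo T (fam K 0) ∧ TensorRestrictsTo (fam K 0) T))
    (hT' : SameSupport T' (fam K 1) ∨
      (TensorRestrictsTo T' (fam K 0) ∧ TensorRestrictsTo (fam K 0) T')) :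
    AlgDegeneratesTo T T' ↔ AlgDegeneratesTo T' T := by
  rcases hT with hT | hT <;> rcases hT' with hT' | hT'
  · exact sameSupport_no_strict_degeneration K hT hT'
  · exact ⟨fun hd => absurd hd (sameSupport_not_algDegeneratesTo_equivZero hT hT'),
      fun hd => absurd hd (equivZero_not_algDegeneratesTo_sameSupport hT' hT)⟩
  · exact ⟨fun hd => absurd hd (equivZero_not_algDegeneratesTo_sameSupport hT hT'),
      fun hd => absurd hd (sameSupport_not_algDegeneratesTo_equivZero hT' hT)⟩
  · exact ⟨fun _ => (hT'.1.trans hT.2).algDegeneratesTo,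
      fun _ => (hT.1.trans hT'.2).algDegeneratesTo⟩

/-- **Comparable members of the closed class are mutual restrictions**, every field.
[cite: BurgisserClausenShokrollahi1997, §20.2] -/
theorem closedClass_comparable_iff
    (hT : SameSupport T (fam K 1) ∨ (TensorRestrictsTo T (fam K 0) ∧ TensorRestrictsTo (fam K 0) T))
    (hT' : SameSupport T' (fam K 1) ∨
      (TensorRestrictsTo T' (fam K 0) ∧ TensorRestrictsTo (fam K 0) T')) :
    (AlgDegeneratesTo T T' ∨ AlgDegeneratesTo T' T) ↔
      (TensorRestrictsTo T T' ∧ TensorRestrictsTo T' T) := by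
  rw [← closedClass_algDegeneratesTo_iff_restrictsTo hT hT',
    ← closedClass_algDegeneratesTo_iff_restrictsTo hT' hT,
    ← closedClass_no_strict_degeneration hT hT', or_self, and_self]

/-- **`⟨2,2,2⟩` against the closed class**, every field: `⟨2,2,2⟩ ⊵ T ↔ ⟨2,2,2⟩ ≥ T` and
`⟨2,2,2⟩ ⊵ T ↔ T ⊵ ⟨2,2,2⟩`. [cite: BurgisserClausenShokrollahi1997, (15.19)] -/
theorem matMul_closedClass
    (hT : SameSupport T (fam K 1) ∨
      (TensorRestrictsTo T (fam K 0) ∧ TensorRestrictsTo (fam K 0) T)) :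
    (AlgDegeneratesTo (matMulTensor K 2 2 (1 + 1)) T ↔
      TensorRestrictsTo (matMulTensor K 2 2 (1 + 1)) T) ∧
    (AlgDegeneratesTo (matMulTensor K 2 2 (1 + 1)) T ↔
      AlgDegeneratesTo T (matMulTensor K 2 2 (1 + 1))) := by
  have hS : SameSupport (fam K 1) (fam K 1) ∨
      (TensorRestrictsTo (fam K 1) (fam K 0) ∧ TensorRestrictsTo (fam K 0) (fam K 1)) :=
    Or.inl fun _ _ _ => Iff.rfl
  obtain ⟨r₁, r₂⟩ := fam_one_restricts K
  have e₁ : AlgDegeneratesTo (matMulTensor K 2 2 (1 + 1)) T ↔ AlgDegeneratesTo (fam K 1) T :=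
    ⟨fun hd => r₂.algDegeneratesTo_trans hd, fun hd => r₁.algDegeneratesTo_trans hd⟩
  have e₂ : AlgDegeneratesTo T (matMulTensor K 2 2 (1 + 1)) ↔ AlgDegeneratesTo T (fam K 1) :=
    ⟨fun hd => hd.trans_restrictsTo r₁, fun hd => hd.trans_restrictsTo r₂⟩
  refine ⟨⟨fun hd => ?_, fun h => h.algDegeneratesTo⟩, ?_⟩
  · exact r₁.trans ((closedClass_algDegeneratesTo_iff_restrictsTo hS hT).mp (e₁.mp hd))
  · rw [e₁, e₂, closedClass_no_strict_degeneration hS hT]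

/-- **`⟨2,2,2⟩` and each of its eight single deletions are `⊴`-incomparable**, every field.
[cite: BurgisserClausenShokrollahi1997, (15.19)] [cite: BlaserChristandlZuiddam2017, Lemma 3] -/
theorem matMul_deleted_incomparable (σ i k : Fin 2)
    (hT : ∀ a x c, (T a x c ≠ 0 ↔ (fam K 1 a x c ≠ 0 ∧ (a, x, c) ≠ pt σ i k))) :
    ¬ AlgDegeneratesTo (matMulTensor K 2 2 (1 + 1)) T ∧
      ¬ AlgDegeneratesTo T (matMulTensor K 2 2 (1 + 1)) := by
  obtain ⟨h₃, h₄⟩ := equiv_fam_zero_of_deleted σ i k hT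
  exact ⟨fun hd => matMul_not_algDegeneratesTo_fam_zero K (hd.trans_restrictsTo h₃),
    fun hd => fam_zero_not_algDegeneratesTo_matMul K (h₄.algDegeneratesTo_trans hd)⟩

/-! ## §5 Support-level corollaries: `supp T = S`, or `S` minus any one entry -/

/-- The closed support class (all eight deletions) lies in the closed class modulo isotropy.
[cite: BlaserChristandlZuiddam2017, Lemma 3] -/
theorem closedSupport_equiv
    (hT : SameSupport T (fam K 1) ∨
      ∃ σ i k : Fin 2, ∀ a x c, (T a x c ≠ 0 ↔ (fam K 1 a x c ≠ 0 ∧ (a, x, c) ≠ pt σ i k))) :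
    SameSupport T (fam K 1) ∨ (TensorRestrictsTo T (fam K 0) ∧ TensorRestrictsTo (fam K 0) T) :=
  hT.imp id fun ⟨σ, i, k, h⟩ => equiv_fam_zero_of_deleted σ i k h

/-- **The closed support class of `⟨2,2,2⟩` — full support or any single deletion — is a total
`⊴`-antichain of `≅`-classes over every field**: degeneration is restriction and is symmetric.
[cite: BurgisserClausenShokrollahi1997, §20.2] [cite: BlaserChristandlZuiddam2017, §2] -/
theorem closedSupport_no_strict_degeneration
    (hT : SameSupport T (fam K 1) ∨
      ∃ σ i k : Fin 2, ∀ a x c, (T a x c ≠ 0 ↔ (fam K 1 a x c ≠ 0 ∧ (a, x, c) ≠ pt σ i k)))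
    (hT' : SameSupport T' (fam K 1) ∨
      ∃ σ i k : Fin 2, ∀ a x c, (T' a x c ≠ 0 ↔ (fam K 1 a x c ≠ 0 ∧ (a, x, c) ≠ pt σ i k))) :
    (AlgDegeneratesTo T T' ↔ TensorRestrictsTo T T') ∧
      (AlgDegeneratesTo T T' ↔ AlgDegeneratesTo T' T) :=
  ⟨closedClass_algDegeneratesTo_iff_restrictsTo (closedSupport_equiv hT) (closedSupport_equiv hT'),
    closedClass_no_strict_degeneration (closedSupport_equiv hT) (closedSupport_equiv hT')⟩

/-- **Over `𝔽₂` the closed support class is exactly two `≅`-classes** — `[⟨2,2,2⟩]` (full support: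
every full-support tensor over `𝔽₂` IS `𝔖(1) ≅ ⟨2,2,2⟩` up to the torus, here trivial) and
`[𝔖(0)]` (the eight deletions) — and they are incomparable.
[cite: BlaserChristandlZuiddam2017, §2] -/
theorem closedSupport_zmod2 {T T' : Leaf2 → (Fin 2 × Fin 2) → Leaf2 → ZMod 2}
    (hT : SameSupport T (fam (ZMod 2) 1)) (σ i k : Fin 2)
    (hT' : ∀ a x c, (T' a x c ≠ 0 ↔ (fam (ZMod 2) 1 a x c ≠ 0 ∧ (a, x, c) ≠ pt σ i k))) :
    (TensorRestrictsTo T (matMulTensor (ZMod 2) 2 2 (1 + 1)) ∧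
        TensorRestrictsTo (matMulTensor (ZMod 2) 2 2 (1 + 1)) T) ∧
      ¬ AlgDegeneratesTo T T' ∧ ¬ AlgDegeneratesTo T' T := by
  have hT₁ : T = fam (ZMod 2) 1 := by
    funext a x c
    have h := hT a x c
    revert h
    generalize T a x c = u
    generalize fam (ZMod 2) 1 a x c = v
    revert u v
    decide
  obtain ⟨r₁, r₂⟩ := fam_one_restricts (ZMod 2)
  subst hT₁
  exact ⟨⟨r₂, r₁⟩,
    sameSupport_not_algDegeneratesTo_equivZero hT (equiv_fam_zero_of_deleted σ i k hT'),
    equivZero_not_algDegeneratesTo_sameSupport (equiv_fam_zero_of_deleted σ i k hT') hT⟩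

end Summit.MatrixMultiplication.MatrixMultiplication.Theorems.FarEdgeDescentCorankOneClasses

end
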